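import Mathlib.Analysis.Calculus.ContDiff.RestrictScalars
import Mathlib.Analysis.Complex.OperatorNorm
import Literature.MathematicalPhysics.QuantumLattice.AngularCutoffLineBounds
import HarnessLib

/-!
# Angular sector cutoffs on the momentum plane: all-order FRÉCHET derivative bounds, uniform in the scale

Topic `MathematicalPhysics/QuantumLattice`.  Companion of `AngularCutoffLineBounds` (which bounds the derivatives of
`ζ̃_{n,ω}(θ(k⃗))` along LINES `t ↦ q⃗ + t w⃗`).  Benfatto–Giuliani–Mastropietro 2006, §2.5 Lemma 2.2 and §2.7 (2.71a) claim "the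
same bounds" for the sectorised symbols `ζ̃_{h,ω}(θ(k⃗))·(…)`; when the angular factor multiplies a symbol whose lattice space
differences are converted into FRÉCHET derivatives on the Euclidean momentum plane (Leibniz `norm_iteratedFDeriv_mul_le`, Faà di
Bruno `norm_iteratedFDeriv_comp_le`, mean value `IteratedDifferenceMixedBound`), the angular factor has to be controlled in the
same currency.  PROVED here: for every `N` there is `B ≥ 0`, independent of `n, ω`, the point and `r₀`, with

  **`‖Dⁱ[P ↦ ζ̃_{n,ω}(θ(P))](P)‖ ≤ N!·B·((1 + N!/w_n)/r₀)ⁱ`**   (`i ≤ N`, `0 < r₀ ≤ ‖P‖`)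

(`exists_norm_iteratedFDeriv_sectorWeightCirc_polarAngle_le`; `P : EuclideanSpace ℝ (Fin 2)`, `θ = polarAngle`,
`w_n = sectorWidth n = π2^{-n}`), and the form with the direction cost `2ⁿ`: `≤ B·((1 + N!)2ⁿ/r₀)ⁱ`.

Method: as on lines — near `P`, `ζ̃_{n,ω}(θ(P′)) = Z(w_n⁻¹·Θ(P′))` with the RESCALED profile `Z(x) = ζ̃_{n,ω}(θ₀ + w_n x)`
(`exists_norm_iteratedDeriv_profile_le`: derivatives bounded uniformly in `n`), base angle `θ₀ = θ(P)` and relative angle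
`Θ = arg ∘ T`, `T P′ = (P′₁ + iP′₂)e^{-iθ₀}` a real-linear map of norm `≤ 1` taking `P` to the positive real axis (off the
cut); the real Fréchet derivatives of `arg = Im log` off the cut are controlled by those of the holomorphic `log`
(restriction of scalars): **`‖D^{k+1} log z‖ = k!/‖z‖^{k+1}`**, **`‖D^{k+1} arg z‖ ≤ k!/‖z‖^{k+1}`**
(`norm_iteratedFDeriv_real_log`, `norm_iteratedFDeriv_arg_le`); then `norm_iteratedFDerivWithin_comp_le`.

Everything is proved; no definitions, no named facts.

## Sources

G. Benfatto, A. Giuliani, V. Mastropietro, Ann. Henri Poincaré 7 (2006) 809–898, §2.5 Lemma 2.2, §2.7 (2.71a)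
(`BenfattoGiulianiMastropietro2006`).
-/

noncomputable section

open Real Set Filter Complex
open scoped Nat Topology

namespace Literature.MathematicalPhysics.QuantumLattice

/-! ### Real Fréchet derivatives of `log` and `arg` off the cut -/

/-- **`‖D^{k+1} log z‖ = k!/‖z‖^{k+1}`** for the REAL Fréchet derivatives of the principal logarithm at a point off the cut
`(-∞,0]`: they are the restrictions of scalars of the complex ones, `log^{(k+1)}(z) = (-1)ᵏk!·z^{-(k+1)}`.
[cite: BenfattoGiulianiMastropietro2006, §2.5 Lemma 2.2] -/
theorem norm_iteratedFDeriv_real_log {z : ℂ} (hz : z ∈ slitPlane) (k : ℕ) :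
    ‖iteratedFDeriv ℝ (k + 1) Complex.log z‖ = k ! / ‖z‖ ^ (k + 1) := by
  have hC : ContDiffAt ℂ (↑(k + 1)) Complex.log z := Complex.contDiffAt_log hz
  rw [← hC.restrictScalars_iteratedFDeriv (𝕜 := ℝ), Function.comp_apply, ContinuousMultilinearMap.norm_restrictScalars,
    norm_iteratedFDeriv_eq_norm_iteratedDeriv, iteratedDeriv_succ']
  -- `deriv log = (·)⁻¹` near `z`
  have hev : deriv Complex.log =ᶠ[𝓝 z] fun w : ℂ => w⁻¹ := by
    filter_upwards [Complex.isOpen_slitPlane.mem_nhds hz] with w hw using (Complex.hasDerivAt_log hw).deriv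
  rw [hev.iteratedDeriv_eq, iteratedDeriv_eq_iterate, iter_deriv_inv, norm_mul, norm_mul, norm_pow, norm_neg, norm_one, one_pow,
    one_mul, Complex.norm_natCast, norm_zpow, show (-1 - (k : ℤ)) = -((k + 1 : ℕ) : ℤ) by push_cast; ring, zpow_neg, zpow_natCast,
    div_eq_mul_inv]

/-- **`‖D^{k+1} arg z‖ ≤ k!/‖z‖^{k+1}`** for the real Fréchet derivatives of the argument at a point off the cut
(`arg = Im ∘ log` there, `‖Im‖ ≤ 1`). [cite: BenfattoGiulianiMastropietro2006, §2.5 Lemma 2.2] -/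
theorem norm_iteratedFDeriv_arg_le {z : ℂ} (hz : z ∈ slitPlane) (k : ℕ) :
    ‖iteratedFDeriv ℝ (k + 1) Complex.arg z‖ ≤ k ! / ‖z‖ ^ (k + 1) := by
  have harg : Complex.arg = fun w => Complex.imCLM (Complex.log w) := by
    funext w; simp [Complex.log_im]
  have hlog : ContDiffOn ℝ (↑(k + 1)) Complex.log slitPlane := fun w hw =>
    ((Complex.contDiffAt_log hw).restrict_scalars ℝ).contDiffWithinAt
  rw [harg, ← iteratedFDerivWithin_of_isOpen (k + 1) Complex.isOpen_slitPlane hz,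
    show (fun w => Complex.imCLM (Complex.log w)) = Complex.imCLM ∘ Complex.log from rfl,
    ContinuousLinearMap.iteratedFDerivWithin_comp_left _ (hlog z hz) Complex.isOpen_slitPlane.uniqueDiffOn hz le_rfl,
    iteratedFDerivWithin_of_isOpen (k + 1) Complex.isOpen_slitPlane hz]
  calc ‖Complex.imCLM.compContinuousMultilinearMap (iteratedFDeriv ℝ (k + 1) Complex.log z)‖
      ≤ ‖Complex.imCLM‖ * ‖iteratedFDeriv ℝ (k + 1) Complex.log z‖ := ContinuousLinearMap.norm_compContinuousMultilinearMap_le _ _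
    _ ≤ 1 * (k ! / ‖z‖ ^ (k + 1)) := by
        rw [norm_iteratedFDeriv_real_log hz k]
        exact mul_le_mul_of_nonneg_right (by rw [Complex.imCLM_norm]) (by positivity)
    _ = k ! / ‖z‖ ^ (k + 1) := one_mul _

/-- `arg` is real-smooth on the slit plane. [cite: BenfattoGiulianiMastropietro2006, §2.5 Lemma 2.2] -/
theorem contDiffOn_arg_slitPlane {n : WithTop ℕ∞} : ContDiffOn ℝ n Complex.arg slitPlane := by
  have harg : Complex.arg = fun w => Complex.imCLM (Complex.log w) := by
    funext w; simp [Complex.log_im]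
  rw [harg]
  exact Complex.imCLM.contDiff.comp_contDiffOn fun w hw => ((Complex.contDiffAt_log hw).restrict_scalars ℝ).contDiffWithinAt

/-- **The derivatives of `arg` within the slit plane**: `‖D^j arg z‖ ≤ (j-1)!/‖z‖ʲ ≤ N!/r₀ʲ` for `1 ≤ j ≤ N + 1`, `‖z‖ ≥ r₀ > 0`.
[cite: BenfattoGiulianiMastropietro2006, §2.5 Lemma 2.2] -/
theorem norm_iteratedFDerivWithin_arg_le {z : ℂ} (hz : z ∈ slitPlane) {r₀ : ℝ} (hr₀ : 0 < r₀) (hr : r₀ ≤ ‖z‖) (N : ℕ) {j : ℕ}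
    (hj1 : 1 ≤ j) (hjN : j ≤ N + 1) :
    ‖iteratedFDerivWithin ℝ j Complex.arg slitPlane z‖ ≤ N ! / r₀ ^ j := by
  obtain ⟨k, rfl⟩ : ∃ k, j = k + 1 := ⟨j - 1, by omega⟩
  rw [iteratedFDerivWithin_of_isOpen (k + 1) Complex.isOpen_slitPlane hz]
  refine (norm_iteratedFDeriv_arg_le hz k).trans ?_
  have hkN : (k ! : ℝ) ≤ N ! := by exact_mod_cast Nat.factorial_le (by omega)
  exact div_le_div₀ (by positivity) hkN (by positivity) (pow_le_pow_left₀ hr₀.le hr _)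

/-! ### The complex coordinate of a Euclidean momentum -/

/-- `k⃗ ↦ k₁ + ik₂` is additive. [cite: BenfattoGiulianiMastropietro2006, §2.5 (2.45)] -/
theorem momToComplex_add (p q : Fin 2 → ℝ) : momToComplex (p + q) = momToComplex p + momToComplex q := by
  apply Complex.ext <;> simp

/-- `k⃗ ↦ k₁ + ik₂` is real-homogeneous. [cite: BenfattoGiulianiMastropietro2006, §2.5 (2.45)] -/
theorem momToComplex_smul (a : ℝ) (p : Fin 2 → ℝ) : momToComplex (a • p) = (a : ℂ) * momToComplex p := by
  apply Complex.ext <;> simp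

/-- `‖P₁ + iP₂‖ = ‖P‖` for `P` in the Euclidean plane. [cite: BenfattoGiulianiMastropietro2006, §2.5 (2.45)] -/
theorem norm_momToComplex_ofLp (P : EuclideanSpace ℝ (Fin 2)) : ‖momToComplex (WithLp.ofLp P)‖ = ‖P‖ := by
  rw [EuclideanSpace.norm_eq, Fin.sum_univ_two, Complex.norm_def, Complex.normSq_apply, momToComplex_re, momToComplex_im,
    Real.norm_eq_abs, Real.norm_eq_abs, sq_abs, sq_abs]
  congr 1
  simp only [sq]

/-- **The rotated complex coordinate is real-linear of norm `≤ 1`**: there is `T : E →L[ℝ] ℂ` (`E` the Euclidean plane) with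
`T P = (P₁ + iP₂)·c` and, when `‖c‖ = 1`, `‖T‖ ≤ 1`. [cite: BenfattoGiulianiMastropietro2006, §2.5 (2.45)] -/
theorem exists_clm_momToComplex_mul (c : ℂ) (hc : ‖c‖ = 1) :
    ∃ T : EuclideanSpace ℝ (Fin 2) →L[ℝ] ℂ, (∀ P, T P = momToComplex (WithLp.ofLp P) * c) ∧ ‖T‖ ≤ 1 := by
  let Tl : EuclideanSpace ℝ (Fin 2) →ₗ[ℝ] ℂ :=
    { toFun := fun P => momToComplex (WithLp.ofLp P) * c
      map_add' := fun P Q => by simp only [WithLp.ofLp_add, momToComplex_add, add_mul]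
      map_smul' := fun a P => by
        simp only [WithLp.ofLp_smul, momToComplex_smul, RingHom.id_apply, Complex.real_smul, mul_assoc] }
  refine ⟨LinearMap.toContinuousLinearMap Tl, fun P => rfl, ?_⟩
  refine ContinuousLinearMap.opNorm_le_bound _ zero_le_one fun P => ?_
  rw [LinearMap.coe_toContinuousLinearMap', show Tl P = momToComplex (WithLp.ofLp P) * c from rfl, norm_mul, hc, mul_one,
    norm_momToComplex_ofLp, one_mul]

/-! ### The main estimate -/

/-- **Angular sector cutoffs on the plane, all orders, uniformly in the scale**: for every `N` there is `B ≥ 0` such that for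
all `i ≤ N`, all `n`, `ω`, all points `P` of the Euclidean momentum plane and `r₀ > 0` with `‖P‖ ≥ r₀`,
`‖Dⁱ[P ↦ ζ̃_{n,ω}(θ(P))](P)‖ ≤ N!·B·((1 + N!/w_n)/r₀)ⁱ`. [cite: BenfattoGiulianiMastropietro2006, §2.5 Lemma 2.2] -/
theorem exists_norm_iteratedFDeriv_sectorWeightCirc_polarAngle_le (N : ℕ) :
    ∃ B : ℝ, 0 ≤ B ∧ ∀ (i : ℕ), i ≤ N → ∀ (n : ℕ) (ω : ℤ) (P : EuclideanSpace ℝ (Fin 2)) {r₀ : ℝ}, 0 < r₀ → r₀ ≤ ‖P‖ →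
      ‖iteratedFDeriv ℝ i (fun P : EuclideanSpace ℝ (Fin 2) => sectorWeightCirc n ω (polarAngle (WithLp.ofLp P))) P‖ ≤
        N ! * B * ((1 + (sectorWidth n)⁻¹ * N !) / r₀) ^ i := by
  obtain ⟨G, hG0, hG⟩ := exists_norm_iteratedDeriv_profile_le N
  refine ⟨G, hG0, fun i hi n ω P r₀ hr₀ hr => ?_⟩
  -- base angle and rotated coordinate
  set θ₀ : ℝ := polarAngle (WithLp.ofLp P) with hθ₀
  obtain ⟨T, hT, hT1⟩ := exists_clm_momToComplex_mul (exp (-(θ₀ * I))) (by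
    rw [Complex.norm_exp]; simp)
  have hTrel : ∀ P' : EuclideanSpace ℝ (Fin 2), arg (T P') = sectorRelAngle θ₀ (WithLp.ofLp P') := fun P' => by
    rw [hT]; rfl
  have hTnorm : ∀ P' : EuclideanSpace ℝ (Fin 2), ‖T P'‖ = ‖P'‖ := fun P' => by
    rw [hT, norm_mul_exp_neg_mul_I, norm_momToComplex_ofLp]
  -- `T P` is the positive real `‖P‖`
  have hP0 : 0 < ‖P‖ := hr₀.trans_le hr
  have hTP : T P = ((‖P‖ : ℝ) : ℂ) := by
    rw [hT, ← norm_momToComplex_ofLp, hθ₀, polarAngle]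
    set z := momToComplex (WithLp.ofLp P)
    calc z * exp (-(arg z * I)) = ‖z‖ * exp (arg z * I) * exp (-(arg z * I)) := by rw [norm_mul_exp_arg_mul_I]
      _ = ‖z‖ := by rw [mul_assoc, ← Complex.exp_add, add_neg_cancel, Complex.exp_zero, mul_one]
  -- the open set off the cut
  set U : Set (EuclideanSpace ℝ (Fin 2)) := T ⁻¹' slitPlane with hU
  have hUo : IsOpen U := Complex.isOpen_slitPlane.preimage T.continuous
  have hPU : P ∈ U := by
    show T P ∈ slitPlane
    rw [hTP]; exact ofReal_mem_slitPlane.2 hP0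
  have hw := sectorWidth_pos n
  -- outer: the rescaled profile
  have hg : ContDiff ℝ N (fun x : ℝ => sectorWeightCirc n ω (θ₀ + sectorWidth n * x)) :=
    (contDiff_sectorWeightCirc n ω).comp (contDiff_const.add (contDiff_const.mul contDiff_id))
  -- inner: the rescaled relative angle
  have hf : ContDiffOn ℝ N (fun P' : EuclideanSpace ℝ (Fin 2) => (sectorWidth n)⁻¹ * arg (T P')) U :=
    contDiffOn_const.mul (contDiffOn_arg_slitPlane.comp T.contDiff.contDiffOn (mapsTo_preimage T slitPlane))
  have hD : ∀ j, 1 ≤ j → j ≤ i →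
      ‖iteratedFDerivWithin ℝ j (fun P' : EuclideanSpace ℝ (Fin 2) => (sectorWidth n)⁻¹ * arg (T P')) U P‖ ≤
        ((1 + (sectorWidth n)⁻¹ * N !) / r₀) ^ j := by
    intro j hj1 hji
    have hfeq : (fun P' : EuclideanSpace ℝ (Fin 2) => (sectorWidth n)⁻¹ * arg (T P')) = (sectorWidth n)⁻¹ • (Complex.arg ∘ ⇑T) := by
      funext P'; simp [smul_eq_mul]
    have hargT : ContDiffWithinAt ℝ j (Complex.arg ∘ ⇑T) U P :=
      (contDiffOn_arg_slitPlane.comp T.contDiff.contDiffOn (mapsTo_preimage T slitPlane)) P hPU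
    rw [hfeq, iteratedFDerivWithin_const_smul_apply hargT hUo.uniqueDiffOn hPU, norm_smul, norm_inv,
      Real.norm_of_nonneg hw.le, hU,
      ContinuousLinearMap.iteratedFDerivWithin_comp_right T (contDiffOn_arg_slitPlane (n := j))
        Complex.isOpen_slitPlane.uniqueDiffOn hUo.uniqueDiffOn hPU le_rfl]
    have h1 : ‖(iteratedFDerivWithin ℝ j Complex.arg slitPlane (T P)).compContinuousLinearMap fun _ => T‖ ≤ N ! / r₀ ^ j := by
      refine (ContinuousMultilinearMap.norm_compContinuousLinearMap_le _ _).trans ?_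
      have hprod : ∏ _k : Fin j, ‖T‖ ≤ 1 := Finset.prod_le_one (fun _ _ => norm_nonneg _) fun _ _ => hT1
      have h2 := norm_iteratedFDerivWithin_arg_le hPU hr₀ (by rw [hTnorm]; exact hr) N hj1 (by omega)
      calc ‖iteratedFDerivWithin ℝ j Complex.arg slitPlane (T P)‖ * ∏ _k : Fin j, ‖T‖
          ≤ N ! / r₀ ^ j * 1 := mul_le_mul h2 hprod (Finset.prod_nonneg fun _ _ => norm_nonneg _) (by positivity)
        _ = N ! / r₀ ^ j := mul_one _
    -- `w⁻¹ N!/r₀ʲ ≤ ((1 + w⁻¹ N!)/r₀)ʲ`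
    have h3 : (sectorWidth n)⁻¹ * N ! ≤ (1 + (sectorWidth n)⁻¹ * N !) ^ j := by
      have h1x : 1 ≤ 1 + (sectorWidth n)⁻¹ * (N ! : ℝ) := le_add_of_nonneg_right (by positivity)
      calc (sectorWidth n)⁻¹ * (N ! : ℝ) ≤ 1 + (sectorWidth n)⁻¹ * N ! := le_add_of_nonneg_left zero_le_one
        _ ≤ (1 + (sectorWidth n)⁻¹ * N !) ^ j := le_self_pow₀ h1x (by omega)
    calc (sectorWidth n)⁻¹ * ‖(iteratedFDerivWithin ℝ j Complex.arg slitPlane (T P)).compContinuousLinearMap fun _ => T‖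
        ≤ (sectorWidth n)⁻¹ * (N ! / r₀ ^ j) := mul_le_mul_of_nonneg_left h1 (by positivity)
      _ = ((sectorWidth n)⁻¹ * N !) / r₀ ^ j := by ring
      _ ≤ (1 + (sectorWidth n)⁻¹ * N !) ^ j / r₀ ^ j := div_le_div_of_nonneg_right h3 (by positivity)
      _ = ((1 + (sectorWidth n)⁻¹ * N !) / r₀) ^ j := by rw [div_pow]
  have hC : ∀ m ≤ i, ‖iteratedFDerivWithin ℝ m (fun x : ℝ => sectorWeightCirc n ω (θ₀ + sectorWidth n * x)) univ
      ((fun P' : EuclideanSpace ℝ (Fin 2) => (sectorWidth n)⁻¹ * arg (T P')) P)‖ ≤ G := fun m hm => by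
    rw [iteratedFDerivWithin_univ, norm_iteratedFDeriv_eq_norm_iteratedDeriv]
    exact hG m (hm.trans hi) n ω θ₀ _
  have hcomp := norm_iteratedFDerivWithin_comp_le (N := (N : WithTop ℕ∞)) hg.contDiffOn hf (by exact_mod_cast hi) uniqueDiffOn_univ
    hUo.uniqueDiffOn (mapsTo_univ _ _) hPU hC hD
  rw [iteratedFDerivWithin_of_isOpen i hUo hPU] at hcomp
  -- the factor IS `Z ∘ f` near `P`
  have hev : (fun P' : EuclideanSpace ℝ (Fin 2) => sectorWeightCirc n ω (polarAngle (WithLp.ofLp P'))) =ᶠ[𝓝 P]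
      ((fun x : ℝ => sectorWeightCirc n ω (θ₀ + sectorWidth n * x)) ∘
        fun P' : EuclideanSpace ℝ (Fin 2) => (sectorWidth n)⁻¹ * arg (T P')) := by
    filter_upwards [hUo.mem_nhds hPU] with P' hP'
    have hk : WithLp.ofLp P' ≠ 0 := by
      intro h0
      have h1 : T P' = 0 := by rw [hT, h0]; simp [momToComplex]
      exact (mem_slitPlane_iff_arg.1 hP').2 h1
    obtain ⟨m, hm⟩ := polarAngle_eq_add_sectorRelAngle θ₀ hk
    simp only [Function.comp_apply]
    rw [mul_inv_cancel_left₀ hw.ne', hTrel, hm, show θ₀ + sectorRelAngle θ₀ (WithLp.ofLp P') + 2 * π * m =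
      θ₀ + sectorRelAngle θ₀ (WithLp.ofLp P') + (m : ℝ) * (2 * π) by ring]
    exact (periodic_sectorWeightCirc n ω).int_mul m _
  rw [(hev.iteratedFDeriv ℝ i).eq_of_nhds]
  refine hcomp.trans ?_
  have hiN : (i ! : ℝ) ≤ N ! := by exact_mod_cast Nat.factorial_le hi
  have hD0 : 0 ≤ ((1 + (sectorWidth n)⁻¹ * N !) / r₀) ^ i := by positivity
  exact mul_le_mul_of_nonneg_right (mul_le_mul_of_nonneg_right hiN hG0) hD0

/-- The same bound with the direction cost `2ⁿ`: `‖Dⁱ[ζ̃_{n,ω}∘θ](P)‖ ≤ B·((1 + N!)2ⁿ/r₀)ⁱ` for `i ≤ N`, `‖P‖ ≥ r₀ > 0`.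
[cite: BenfattoGiulianiMastropietro2006, §2.5 Lemma 2.2] -/
theorem exists_norm_iteratedFDeriv_sectorWeightCirc_polarAngle_le' (N : ℕ) :
    ∃ B : ℝ, 0 ≤ B ∧ ∀ (i : ℕ), i ≤ N → ∀ (n : ℕ) (ω : ℤ) (P : EuclideanSpace ℝ (Fin 2)) {r₀ : ℝ}, 0 < r₀ → r₀ ≤ ‖P‖ →
      ‖iteratedFDeriv ℝ i (fun P : EuclideanSpace ℝ (Fin 2) => sectorWeightCirc n ω (polarAngle (WithLp.ofLp P))) P‖ ≤
        B * ((1 + N !) * (2 : ℝ) ^ n / r₀) ^ i := by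
  obtain ⟨B, hB0, hB⟩ := exists_norm_iteratedFDeriv_sectorWeightCirc_polarAngle_le N
  refine ⟨N ! * B, by positivity, fun i hi n ω P r₀ hr₀ hr => (hB i hi n ω P hr₀ hr).trans ?_⟩
  have hw := sectorWidth_pos n
  have hD0 : 0 ≤ (1 + (sectorWidth n)⁻¹ * N !) / r₀ := by positivity
  refine mul_le_mul_of_nonneg_left (pow_le_pow_left₀ hD0 ?_ i) (by positivity)
  exact div_le_div_of_nonneg_right (one_add_inv_sectorWidth_mul_le n N) hr₀.le

/-- **Scale zero**: `‖Dⁱ[ζ̃_{0,ω}∘θ](P)‖ ≤ B·((1 + N!)/r₀)ⁱ` (`i ≤ N`, `‖P‖ ≥ r₀ > 0`) — the two sectors of scale `h = 0`.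
[cite: BenfattoGiulianiMastropietro2006, §2.5 Lemma 2.2] -/
theorem exists_norm_iteratedFDeriv_sectorWeightCirc_zero_polarAngle_le (N : ℕ) :
    ∃ B : ℝ, 0 ≤ B ∧ ∀ (i : ℕ), i ≤ N → ∀ (ω : ℤ) (P : EuclideanSpace ℝ (Fin 2)) {r₀ : ℝ}, 0 < r₀ → r₀ ≤ ‖P‖ →
      ‖iteratedFDeriv ℝ i (fun P : EuclideanSpace ℝ (Fin 2) => sectorWeightCirc 0 ω (polarAngle (WithLp.ofLp P))) P‖ ≤
        B * ((1 + N !) / r₀) ^ i := by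
  obtain ⟨B, hB0, hB⟩ := exists_norm_iteratedFDeriv_sectorWeightCirc_polarAngle_le' N
  refine ⟨B, hB0, fun i hi ω P r₀ hr₀ hr => ?_⟩
  have h := hB i hi 0 ω P hr₀ hr
  rwa [pow_zero, mul_one] at h

end Literature.MathematicalPhysics.QuantumLattice
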